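import Mathlib.Probability.Moments.Covariance
import Summits.Ventures.YMGap.Thresholds.SharpClusteringDecay
import Summits.Ventures.YMGap.Thresholds.SharpClusteringWilson
import Summits.Ventures.YMGap.Thresholds.SharpClusteringTorus
import Summits.Ventures.YMGap.Thresholds.SharpWindow
import Summits.Ventures.YMGap.Thresholds.LatticeBakryEmeryL2
import Literature.MathematicalPhysics.QuantumFieldTheory.QuasiLocalGaugePerturbationKernels
import Summits.Ventures.YMGap.Thresholds.SharpClusteringLimitPrep
import Summits.Ventures.YMGap.RobustBall.Defs
import Mathlib.Analysis.Calculus.BumpFunction.SmoothApprox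
import Mathlib.Analysis.Calculus.BumpFunction.FiniteDimension
import Mathlib.Analysis.SpecialFunctions.Exponential
import Literature.Analysis.Calculus.ExpDifferentialLogQuotient
import HarnessLib

/-!
# BEDoor / Currency — §1–§3 Hessian-currency algebra with the EXCHANGE LEMMA, the finite-range door, THE NUMBER in Hessian currency
# (module 01/11 of the Bakry–Émery door, LIFT edition v8.3 = parts `Exchange` (v8.2 module 01), `FiniteRange` (v8.2 module 02); cell `ym-beyond`, seat P4)

HONEST FRAMING (cell `ym-beyond`, seat P4 «Hessian-currency receiver», lens Y2; HUMAN RULINGS D-0035 / D-0037; memo `HOME/ROUTE-P4Y2.md` v8.1 +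
g10 addendum, spec `HOME/ROUTE-P4Y2-LIFT-SPEC-v83.md`; LIFT edition v8.3 = the v8.2 module bodies of `HOME/ROUTE-P4Y2-Sketch.lean` v8.1, byte-identical and in
order, re-packed into 11 ≤ 400-line modules (fewer olean round-trips; director-ym line №2 (B)); the g10 appendix `OpenStrip` is a separate, UNQUEUED HOME file (line №3 (D))).  FINITE-LATTICE
statements at STRONG effective coupling: a RECEIVER («door») in HESSIAN (Bakry–Émery) currency for renormalisation-group output, typed over the
tree's generic clustering chain `Thresholds/SharpClustering*` + `Thresholds/LatticeBakryEmery*`, complementary to the Dobrushin-currency door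
`YM4Door/*` (LITERALLY the same INPUT predicate `QuasiLocalGaugePerturbation.HasAnalyticNormLE … stripDomain`, the same OUTPUT predicate
`RobustBall.ClustersWith`; no residual hypothesis: Osgood regularity is the tree's `Literature.Analysis.Complex.SCV.contDiffOn_infty`,
part `Osgood` of module `AnalyticStrip`).  Nothing here is a statement about `β → ∞`, the continuum limit or the Clay problem; NO effective action is asserted to be at
the door (that INPUT is not in print for `d = 4`); the verdict «the two windows do not meet» is unchanged in this currency.
WHAT THIS IS NOT (ladder rung R2d; director-ym line №2 (B)): every door of this LIFT is an entry on the STRONG-COUPLING BANK of THE NUMBER —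
finite-lattice exponential clustering at SMALL `|β|` and small strip norm `η` of the perturbation (`SU(2)`, `d = 4`: `16.2|β| + 4.4η < 1`, module `SU2`,
conclusion literally `RobustBall.ClustersWith`) — NOT clustering at weak coupling, NOT a statement at large `β`, NOT the mass gap.
No conjecture name, no `sorry`, no axiom beyond the standard three; every theorem is bookkeeping over the tree. [folklore]
References: H. Shen, R. Zhu, X. Zhu, CMP 400 (2023) 805 (arXiv:2204.12737) Thm 1.2, Cor. 4.4/4.11; D. Bakry, M. Émery, LNM 1123 (1985);
T. Bałaban, CMP 109 (1987) 249, (1.18)–(1.22) (analyticity format); L. Hörmander, An Introduction to Complex Analysis in Several Variables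
(1973) Thm 2.2.1/2.2.6 (Osgood); E. J. McShane, Bull. AMS 40 (1934) 837 (Lipschitz extension).

THIS MODULE, part `Exchange` (§1 currency algebra and the EXCHANGE LEMMA): `hessBound_add`, `offDiagHessBound_add`, `HessBoundOn`, `hessLoad`, ★
`hessBound_sum_of_local` (localised Hessian bounds `HessBoundOn (R i) (X i) (Λ i)` sum to the PER-LINK HESSIAN LOAD `sup_e Σ_{i : e ∈ X i} Λ i` —
intensive, not the extensive `Σ Λ i`).

THIS MODULE, part `FiniteRange` (§2 the finite-range door, §3 THE NUMBER in Hessian currency): `beDoor_abs_le` / `beDoor_gibbsCov_le` (S = wilsonPot β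
+ R, R polynomial with `HessBound R Λ_R` and a finite-range off-diagonal profile; door `N/2 − (N|β|Λ₀ + Λ_R) > 0` ⇒ volume-uniform exponential
clustering of smooth observables, ONE LINE from `SharpClustering.cov_exp_decay_of_distFun`); `beDoor_window_su2_d4` (`β_W < (1 − Λ_R)/8`),
`beDoor_ceiling_su2_d4` (ceiling `β_W = 1/8` by the tree's `four_d_le_of_wilsonHessianBound'`), `beDoor_gsq`, `crossover_ratio`.
-/

noncomputable section

open scoped Matrix ComplexConjugate BigOperators Matrix.Norms.Frobenius ContDiff Topology
open Matrix Complex Finset MeasureTheory Filter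
open Literature.MathematicalPhysics.QuantumFieldTheory
open Literature.MathematicalPhysics.QuantumFieldTheory.SUNBakryEmery (SUN FrameIdx frame)

namespace Summit.Ventures.YMGap.BEDoor

open Summit.Ventures.YMGap Summit.Ventures.YMGap.LatticeBakryEmery Summit.Ventures.YMGap.SharpClustering
open Summit.Ventures.YMGap.HessianSharp

universe u

/-! ## ── part 01 · `Exchange` — §1 currency algebra and the EXCHANGE LEMMA ── -/

/-! ## §1 Currency algebra: additivity and the localised exchange lemma -/

section Additivity

variable {ι : Type u} [Fintype ι] [DecidableEq ι] {N : ℕ}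

omit [DecidableEq ι] in
/-- `HessBound` is additive on smooth potentials. [folklore] -/
theorem hessBound_add {S₁ S₂ : Cfg ι N → ℝ} (h₁ : ContDiff ℝ ∞ S₁) (h₂ : ContDiff ℝ ∞ S₂) {Λ₁ Λ₂ : ℝ}
    (hH₁ : HessBound S₁ Λ₁) (hH₂ : HessBound S₂ Λ₂) : HessBound (S₁ + S₂) (Λ₁ + Λ₂) := by
  intro g V hV hV0
  have e1 : algD V (S₁ + S₂) = algD V S₁ + algD V S₂ := algD_add h₁ h₂ V
  have e2 : algD V (algD V (S₁ + S₂)) = algD V (algD V S₁) + algD V (algD V S₂) := by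
    rw [e1]; exact algD_add (contDiff_algD h₁ V) (contDiff_algD h₂ V) V
  rw [e2, Pi.add_apply, add_mul]
  exact (abs_add_le _ _).trans (add_le_add (hH₁ g V hV hV0) (hH₂ g V hV hV0))

/-- `OffDiagHessBound` is additive on smooth potentials. [folklore] -/
theorem offDiagHessBound_add {S₁ S₂ : Cfg ι N → ℝ} (h₁ : ContDiff ℝ ∞ S₁) (h₂ : ContDiff ℝ ∞ S₂)
    {k₁ k₂ : ι → ι → ℝ} (hO₁ : OffDiagHessBound S₁ k₁) (hO₂ : OffDiagHessBound S₂ k₂) :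
    OffDiagHessBound (S₁ + S₂) (k₁ + k₂) := by
  intro g e e' hne X Y hX hX0 hY hY0
  have e1 : algD (lk e' Y) (S₁ + S₂) = algD (lk e' Y) S₁ + algD (lk e' Y) S₂ := algD_add h₁ h₂ _
  have e2 : algD (lk e X) (algD (lk e' Y) (S₁ + S₂)) =
      algD (lk e X) (algD (lk e' Y) S₁) + algD (lk e X) (algD (lk e' Y) S₂) := by
    rw [e1]; exact algD_add (contDiff_algD h₁ _) (contDiff_algD h₂ _) _
  rw [e2, Pi.add_apply]
  calc |algD (lk e X) (algD (lk e' Y) S₁) (emb g) + algD (lk e X) (algD (lk e' Y) S₂) (emb g)|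
      ≤ |algD (lk e X) (algD (lk e' Y) S₁) (emb g)| + |algD (lk e X) (algD (lk e' Y) S₂) (emb g)| :=
        abs_add_le _ _
    _ ≤ k₁ e e' * frobNorm X * frobNorm Y + k₂ e e' * frobNorm X * frobNorm Y :=
        add_le_add (hO₁ g e e' hne X Y hX hX0 hY hY0) (hO₂ g e e' hne X Y hX hX0 hY hY0)
    _ = (k₁ + k₂) e e' * frobNorm X * frobNorm Y := by simp only [Pi.add_apply]; ring

omit [DecidableEq ι] in
/-- `algD` commutes with finite sums of smooth functions (and the sum is smooth). [folklore] -/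
theorem algD_finset_sum {κ : Type*} (s : Finset κ) {F : κ → Cfg ι N → ℝ} (hF : ∀ i, ContDiff ℝ ∞ (F i))
    (A : Cfg ι N) :
    algD A (∑ i ∈ s, F i) = ∑ i ∈ s, algD A (F i) ∧ ContDiff ℝ ∞ (∑ i ∈ s, F i) := by
  classical
  induction s using Finset.induction_on with
  | empty =>
    refine ⟨?_, ?_⟩
    · rw [Finset.sum_empty, Finset.sum_empty]
      exact algD_const (𝔸 := Cfg ι N) 0 A
    · rw [Finset.sum_empty]; exact contDiff_const
  | insert a s ha ih =>
    obtain ⟨ih1, ih2⟩ := ih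
    refine ⟨?_, ?_⟩
    · rw [Finset.sum_insert ha, Finset.sum_insert ha, algD_add (hF a) ih2, ih1]
    · rw [Finset.sum_insert ha]; exact (hF a).add ih2

/-- **Localised Hessian bound**: `|D_V D_V R (g)| ≤ Λ · ∑_{e ∈ X} ‖V e‖_F²` — the Hessian of a term living on the
link set `X` only sees the components of the direction `V` on `X`. [folklore] -/
@[folklore]
def HessBoundOn (R : Cfg ι N → ℝ) (X : Finset ι) (Λ : ℝ) : Prop :=
  ∀ (g : PSU ι N) (V : Cfg ι N), (∀ e, (V e)ᴴ = -V e) → (∀ e, (V e).trace = 0) →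
    |algD V (algD V R) (emb g)| ≤ Λ * ∑ e ∈ X, frobNorm (V e) ^ 2

/-- The **per-link Hessian load** of a finite family of localised Hessian bounds: `∑_{i : e ∈ X i} Λ i`. [folklore] -/
def hessLoad {κ : Type*} (s : Finset κ) (X : κ → Finset ι) (Λ : κ → ℝ) (e : ι) : ℝ :=
  ∑ i ∈ s, if e ∈ X i then Λ i else 0

omit [DecidableEq ι] in
/-- A localised bound is a global one (drop the restriction to `X`). [folklore] -/
theorem HessBoundOn.hessBound {R : Cfg ι N → ℝ} {X : Finset ι} {Λ : ℝ} (hΛ : 0 ≤ Λ) (h : HessBoundOn R X Λ) :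
    HessBound R Λ := fun g V hV hV0 =>
  (h g V hV hV0).trans (mul_le_mul_of_nonneg_left
    (Finset.sum_le_sum_of_subset_of_nonneg (Finset.subset_univ X) fun _ _ _ => sq_nonneg _) hΛ)

/-- **THE EXCHANGE LEMMA (Hessian currency is intensive iff localised).**  For a finite family of smooth terms
`R i` with localised Hessian bounds `HessBoundOn (R i) (X i) (Λ i)` (any signs), the sum has the GLOBAL Hessian
bound `HessBound (∑ R i) η` as soon as the per-link Hessian load is `≤ η` at every link:
`sup_e ∑_{i : e ∈ X i} Λ i ≤ η`.  (Plain additivity would give the extensive constant `∑ Λ i`.)  With the Cauchy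
estimate `Λ_X ≤ 2 M_X / r²` for a polymer activity analytic and bounded by `M_X` on a complex strip of width `r`
(memo §2, not formalised) this reads `η ≤ (2/r²) · sup_e ∑_{X ∋ e} M_X`. [folklore] -/
theorem hessBound_sum_of_local {κ : Type*} (s : Finset κ) {R : κ → Cfg ι N → ℝ} (hR : ∀ i, ContDiff ℝ ∞ (R i))
    {X : κ → Finset ι} {Λ : κ → ℝ} (hB : ∀ i ∈ s, HessBoundOn (R i) (X i) (Λ i))
    {η : ℝ} (hη : ∀ e, hessLoad s X Λ e ≤ η) : HessBound (∑ i ∈ s, R i) η := by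
  classical
  intro g V hV hV0
  have h1 := algD_finset_sum s hR V
  have h2 := algD_finset_sum s (fun i => contDiff_algD (hR i) V) V
  rw [h1.1, h2.1, Finset.sum_apply]
  calc |∑ i ∈ s, algD V (algD V (R i)) (emb g)|
      ≤ ∑ i ∈ s, |algD V (algD V (R i)) (emb g)| := Finset.abs_sum_le_sum_abs _ _
    _ ≤ ∑ i ∈ s, Λ i * ∑ e ∈ X i, frobNorm (V e) ^ 2 := Finset.sum_le_sum fun i hi => hB i hi g V hV hV0
    _ = ∑ i ∈ s, ∑ e, (if e ∈ X i then Λ i else 0) * frobNorm (V e) ^ 2 := by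
        refine Finset.sum_congr rfl fun i _ => ?_
        rw [Finset.mul_sum]
        rw [← Finset.sum_filter_add_sum_filter_not Finset.univ (fun e => e ∈ X i)]
        have hA : ∑ e ∈ Finset.univ.filter (fun e => e ∈ X i), (if e ∈ X i then Λ i else 0) * frobNorm (V e) ^ 2
            = ∑ e ∈ X i, Λ i * frobNorm (V e) ^ 2 := by
          have hs : Finset.univ.filter (fun e => e ∈ X i) = X i := by ext e; simp
          rw [hs]; exact Finset.sum_congr rfl fun e he => by rw [if_pos he]
        have hB0 : ∑ e ∈ Finset.univ.filter (fun e => ¬ e ∈ X i), (if e ∈ X i then Λ i else 0) * frobNorm (V e) ^ 2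
            = 0 := Finset.sum_eq_zero fun e he => by
          rw [Finset.mem_filter] at he; rw [if_neg he.2, zero_mul]
        rw [hA, hB0, add_zero]
    _ = ∑ e, hessLoad s X Λ e * frobNorm (V e) ^ 2 := by
        rw [Finset.sum_comm]; exact Finset.sum_congr rfl fun e _ => by rw [hessLoad, Finset.sum_mul]
    _ ≤ ∑ e, η * frobNorm (V e) ^ 2 :=
        Finset.sum_le_sum fun e _ => mul_le_mul_of_nonneg_right (hη e) (sq_nonneg _)
    _ = η * ∑ e, frobNorm (V e) ^ 2 := by rw [Finset.mul_sum]

/-- Plain additivity of off-diagonal profiles over a finite family. [folklore] -/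
theorem offDiagHessBound_sum {κ : Type*} (s : Finset κ) {R : κ → Cfg ι N → ℝ} (hR : ∀ i, ContDiff ℝ ∞ (R i))
    {k : κ → ι → ι → ℝ} (hO : ∀ i ∈ s, OffDiagHessBound (R i) (k i)) :
    OffDiagHessBound (∑ i ∈ s, R i) (∑ i ∈ s, k i) := by
  classical
  induction s using Finset.induction_on with
  | empty =>
    intro g e e' hne X Y hX hX0 hY hY0
    rw [Finset.sum_empty, Finset.sum_empty]
    have h0 : algD (lk e' Y) (0 : Cfg ι N → ℝ) = 0 := algD_const (𝔸 := Cfg ι N) 0 _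
    rw [h0]
    have h00 : algD (lk e X) (0 : Cfg ι N → ℝ) = 0 := algD_const (𝔸 := Cfg ι N) 0 _
    rw [h00]; simp
  | insert a s ha ih =>
    rw [Finset.sum_insert ha, Finset.sum_insert ha]
    exact offDiagHessBound_add (hR a) (algD_finset_sum s hR 0).2 (hO a (Finset.mem_insert_self a s))
      (ih fun i hi => hO i (Finset.mem_insert_of_mem hi))

end Additivity

/-! ## ── part 02 · `FiniteRange` — §2 the finite-range door, §3 THE NUMBER in Hessian currency ── -/

/-! ## §2 The Bakry–Émery door in Hessian currency on the torus -/

section Door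

variable {d N : ℕ} {L : ℕ} [NeZero L]

/-- **THE DOOR (un-normalised form).**  Torus `(ℤ/L)^d`, `L ≥ 2`; `S = wilsonPot β + R` with `R` polynomial in the
link entries, `HessBound R Λ_R`, off-diagonal profile `h_R ≥ 0` symmetric with rows `≤ H_R`; Wilson Hessian constant
`Λ₀` (`WilsonHessianBound d N Λ₀`, e.g. `Λ₀ = 4d`); DOOR CONDITION `K := N/2 − (N|β|Λ₀ + Λ_R) > 0`.  Then for smooth
`u, v` with per-link Lipschitz data `δu, δv ≥ 0`, and any `D : links → ℕ` that is 1-Lipschitz along Wilson neighbours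
and along the support of `h_R`, vanishes on the support of `δv` and is `≥ m` on the support of `δu`:
`|Z ∫ e^S uv − ∫ e^S u ∫ e^S v| ≤ Z² · (2/K) e^{−min(1, K/(4(H_W⁺+H_R)+1))·m} (Σδu)(Σδv)`, `H_W⁺ = max(6(d−1)N|β|, 0)`.
One application of `SharpClustering.cov_exp_decay_of_distFun`. [folklore] -/
theorem beDoor_abs_le {Λ₀ : ℝ} (hH : WilsonHessianBound d N Λ₀) (hN : N ≠ 0) (β : ℝ) (hL : 1 < L)
    {R : Cfg (Edge d L) N → ℝ} {dR : ℕ} (hRp : R ∈ polySpace (Edge d L) N dR)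
    {ΛR : ℝ} (hRH : HessBound R ΛR) {hR : Edge d L → Edge d L → ℝ} (hRO : OffDiagHessBound R hR)
    (hR0 : ∀ e e', 0 ≤ hR e e') (hRsymm : ∀ e e', hR e e' = hR e' e) {HR : ℝ} (hHR0 : 0 ≤ HR)
    (hRrow : ∀ e, ∑ e', hR e e' ≤ HR) (hK : 0 < (N : ℝ) / 2 - ((N : ℝ) * |β| * Λ₀ + ΛR))
    {u v : Cfg (Edge d L) N → ℝ} (hu : ContDiff ℝ ∞ u) (hv : ContDiff ℝ ∞ v)
    {δu δv : Edge d L → ℝ} (hδu : ∀ e, 0 ≤ δu e) (hδv : ∀ e, 0 ≤ δv e)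
    (hLu : LinkLipschitz u δu) (hLv : LinkLipschitz v δv)
    (D : Edge d L → ℕ) (hD : ∀ e e', (e' ∈ linkNbrT e ∨ hR e e' ≠ 0) → D e ≤ D e' + 1)
    (hDv : ∀ e, δv e ≠ 0 → D e = 0) {m : ℕ} (hDu : ∀ e, δu e ≠ 0 → m ≤ D e) :
    |(∫ x : PSU (Edge d L) N, Real.exp ((wilsonPot d N L β + R) (emb x)) ∂(haarPi (Edge d L) N)) *
          (∫ x : PSU (Edge d L) N, Real.exp ((wilsonPot d N L β + R) (emb x)) * (u (emb x) * v (emb x))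
            ∂(haarPi (Edge d L) N)) -
        (∫ x : PSU (Edge d L) N, Real.exp ((wilsonPot d N L β + R) (emb x)) * u (emb x) ∂(haarPi (Edge d L) N)) *
          (∫ x : PSU (Edge d L) N, Real.exp ((wilsonPot d N L β + R) (emb x)) * v (emb x) ∂(haarPi (Edge d L) N))|
      ≤ (∫ x : PSU (Edge d L) N, Real.exp ((wilsonPot d N L β + R) (emb x)) ∂(haarPi (Edge d L) N)) ^ 2 *
        (2 / ((N : ℝ) / 2 - ((N : ℝ) * |β| * Λ₀ + ΛR)) *
          Real.exp (-(min 1 (((N : ℝ) / 2 - ((N : ℝ) * |β| * Λ₀ + ΛR)) /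
            (4 * (max (6 * ((d : ℝ) - 1) * N * |β|) 0 + HR) + 1))) * m) *
          (∑ e, δu e) * (∑ e, δv e)) := by
  have hSp : wilsonPot d N L β + R ∈ polySpace (Edge d L) N (max 4 dR) :=
    Submodule.add_mem _ (polySpace_mono (le_max_left 4 dR) (wilsonPot_mem_polySpace (d := d) (N := N) (L := L) β))
      (polySpace_mono (le_max_right 4 dR) hRp)
  have hHess : HessBound (wilsonPot d N L β + R) ((N : ℝ) * |β| * Λ₀ + ΛR) :=
    hessBound_add (contDiff_wilsonPot β) (contDiff_of_mem_polySpace hRp) (hessBound_wilsonPot hH β) hRH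
  have hOff : OffDiagHessBound (wilsonPot d N L β + R) (wilsonH d N L β + hR) :=
    offDiagHessBound_add (contDiff_wilsonPot β) (contDiff_of_mem_polySpace hRp) (offDiagHessBound_wilsonPot hL β) hRO
  have hh0 : ∀ e e', 0 ≤ (wilsonH d N L β + hR) e e' := fun e e' => by
    simp only [Pi.add_apply]; exact add_nonneg (wilsonH_nonneg N β e e') (hR0 e e')
  have hsymm : ∀ e e', (wilsonH d N L β + hR) e e' = (wilsonH d N L β + hR) e' e := fun e e' => by
    simp only [Pi.add_apply]; rw [wilsonH_symm N β e e', hRsymm e e']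
  have hHp0 : 0 ≤ max (6 * ((d : ℝ) - 1) * N * |β|) 0 + HR := add_nonneg (le_max_right _ _) hHR0
  have hrow : ∀ e, ∑ e', (wilsonH d N L β + hR) e e' ≤ max (6 * ((d : ℝ) - 1) * N * |β|) 0 + HR := fun e => by
    simp only [Pi.add_apply]
    rw [Finset.sum_add_distrib]
    exact add_le_add ((sum_wilsonH_le N β e).trans (le_max_left _ _)) (hRrow e)
  have hD' : ∀ e e', (wilsonH d N L β + hR) e e' ≠ 0 → D e ≤ D e' + 1 := fun e e' hne => by
    by_cases hw : wilsonH d N L β e e' = 0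
    · refine hD e e' (Or.inr ?_)
      intro h0; apply hne; simp only [Pi.add_apply, hw, h0, add_zero]
    · exact hD e e' (Or.inl (mem_linkNbrT_of_wilsonH_ne_zero N hw))
  exact cov_exp_decay_of_distFun hN hSp hHess hK hOff hh0 hsymm hHp0 hrow D hD' hu hv hδu hδv hLu hLv hDv hDu

variable {ι : Type u} [Fintype ι] [DecidableEq ι] in
/-- The normalised (Gibbs) covariance of `u, v` in the tilted product Haar measure `Z⁻¹ e^{S} dσ^{⊗E}`. [folklore] -/
def gibbsCov (S u v : Cfg ι N → ℝ) : ℝ :=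
  (∫ x : PSU ι N, Real.exp (S (emb x)) * (u (emb x) * v (emb x)) ∂(haarPi ι N)) /
      (∫ x : PSU ι N, Real.exp (S (emb x)) ∂(haarPi ι N)) -
    (∫ x : PSU ι N, Real.exp (S (emb x)) * u (emb x) ∂(haarPi ι N)) /
        (∫ x : PSU ι N, Real.exp (S (emb x)) ∂(haarPi ι N)) *
      ((∫ x : PSU ι N, Real.exp (S (emb x)) * v (emb x) ∂(haarPi ι N)) /
        (∫ x : PSU ι N, Real.exp (S (emb x)) ∂(haarPi ι N)))

/-- Algebra: `I_uv/Z − (I_u/Z)(I_v/Z) = (Z I_uv − I_u I_v)/Z²`. [folklore] -/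
theorem gibbsCov_eq_div {Z Iuv Iu Iv : ℝ} (hZ : Z ≠ 0) :
    Iuv / Z - Iu / Z * (Iv / Z) = (Z * Iuv - Iu * Iv) / Z ^ 2 := by
  field_simp

/-- **THE DOOR (normalised form)**: under the hypotheses of `beDoor_abs_le`,
`|Cov_{Z⁻¹e^{S}}(u, v)| ≤ (2/K) e^{−min(1, K/(4(H_W⁺+H_R)+1))·m} (Σδu)(Σδv)` — ONE constant for every torus side
`L ≥ 2`, every pair of smooth observables and every polynomial remainder inside the door. [folklore] -/
theorem beDoor_gibbsCov_le {Λ₀ : ℝ} (hH : WilsonHessianBound d N Λ₀) (hN : N ≠ 0) (β : ℝ) (hL : 1 < L)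
    {R : Cfg (Edge d L) N → ℝ} {dR : ℕ} (hRp : R ∈ polySpace (Edge d L) N dR)
    {ΛR : ℝ} (hRH : HessBound R ΛR) {hR : Edge d L → Edge d L → ℝ} (hRO : OffDiagHessBound R hR)
    (hR0 : ∀ e e', 0 ≤ hR e e') (hRsymm : ∀ e e', hR e e' = hR e' e) {HR : ℝ} (hHR0 : 0 ≤ HR)
    (hRrow : ∀ e, ∑ e', hR e e' ≤ HR) (hK : 0 < (N : ℝ) / 2 - ((N : ℝ) * |β| * Λ₀ + ΛR))
    {u v : Cfg (Edge d L) N → ℝ} (hu : ContDiff ℝ ∞ u) (hv : ContDiff ℝ ∞ v)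
    {δu δv : Edge d L → ℝ} (hδu : ∀ e, 0 ≤ δu e) (hδv : ∀ e, 0 ≤ δv e)
    (hLu : LinkLipschitz u δu) (hLv : LinkLipschitz v δv)
    (D : Edge d L → ℕ) (hD : ∀ e e', (e' ∈ linkNbrT e ∨ hR e e' ≠ 0) → D e ≤ D e' + 1)
    (hDv : ∀ e, δv e ≠ 0 → D e = 0) {m : ℕ} (hDu : ∀ e, δu e ≠ 0 → m ≤ D e) :
    |gibbsCov (wilsonPot d N L β + R) u v| ≤
      2 / ((N : ℝ) / 2 - ((N : ℝ) * |β| * Λ₀ + ΛR)) *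
        Real.exp (-(min 1 (((N : ℝ) / 2 - ((N : ℝ) * |β| * Λ₀ + ΛR)) /
          (4 * (max (6 * ((d : ℝ) - 1) * N * |β|) 0 + HR) + 1))) * m) *
        (∑ e, δu e) * (∑ e, δv e) := by
  set S := wilsonPot d N L β + R with hS
  have hSc : Continuous fun U : PSU (Edge d L) N => S (emb U) :=
    continuous_restrict ((contDiff_wilsonPot β).add (contDiff_of_mem_polySpace hRp))
  set Z : ℝ := ∫ U, Real.exp (S (emb U)) ∂(haarPi (Edge d L) N) with hZ
  have hZpos : 0 < Z := integral_exp_pos (integrable_of_continuous_PSU (Real.continuous_exp.comp hSc) _)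
  have hmain := beDoor_abs_le hH hN β hL hRp hRH hRO hR0 hRsymm hHR0 hRrow hK hu hv hδu hδv hLu hLv D hD hDv hDu
  rw [gibbsCov, gibbsCov_eq_div hZpos.ne', abs_div, abs_of_pos (pow_pos hZpos 2), div_le_iff₀ (pow_pos hZpos 2)]
  refine hmain.trans (le_of_eq ?_)
  rw [← hS]
  ring

end Door

/-! ## §3 THE NUMBER in Hessian currency (`SU(2)`, `d = 4`) -/

section Numbers

/-- The door condition in Wilson-coupling form for `SU(2)`, `d = 4` (`N/2 = 1`, Wilson Hessian constant `Λ₀ = 4d = 16`,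
't Hooft `β ≥ 0`, `β_W = 4β`): `K = 1 − (2β·16 + Λ_R) > 0 ⇔ β_W < (1 − Λ_R)/8`. [folklore] -/
theorem beDoor_window_su2_d4 {β ΛR : ℝ} (hβ : 0 ≤ β) :
    0 < (2 : ℝ) / 2 - ((2 : ℝ) * |β| * (4 * (4 : ℕ)) + ΛR) ↔ 4 * β < (1 - ΛR) / 8 := by
  rw [abs_of_nonneg hβ]; push_cast
  constructor <;> intro h <;> linarith

/-- Pure Wilson (`Λ_R = 0`): the door is `β_W < 1/8` — the tree's sharp window
(`HessianSharp.sharpThresholdSU_wilson_values`; printed SZZ bar `1/12`). [folklore] -/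
theorem beDoor_window_su2_d4_pure {β : ℝ} (hβ : 0 ≤ β) :
    0 < (2 : ℝ) / 2 - ((2 : ℝ) * |β| * (4 * (4 : ℕ)) + 0) ↔ 4 * β < 1 / 8 := by
  rw [beDoor_window_su2_d4 hβ]; norm_num

/-- **CEILING of the pure Hessian door** (the BC9-type ladder ceiling of pointwise Bakry–Émery for the Wilson action):
by the tree's OPTIMALITY theorem `four_d_le_of_wilsonHessianBound'` every admissible Wilson Hessian constant in `d = 4`
is `≥ 16`, so NO choice of `Λ₀` opens the pure door (`Λ_R = 0`) at or beyond `β_W = 1/8`. [folklore] -/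
theorem beDoor_ceiling_su2_d4 {Λ₀ β : ℝ} (hH : WilsonHessianBound 4 2 Λ₀)
    (hK : 0 < (2 : ℝ) / 2 - ((2 : ℝ) * |β| * Λ₀ + 0)) : 4 * |β| < 1 / 8 := by
  have h16 : 4 * ((4 : ℕ) : ℝ) ≤ Λ₀ := four_d_le_of_wilsonHessianBound' (d := 4) (N := 2) (by norm_num) (by norm_num) hH
  have h16' : (16 : ℝ) ≤ Λ₀ := by push_cast at h16; linarith
  have hb : 2 * |β| * 16 ≤ 2 * |β| * Λ₀ := mul_le_mul_of_nonneg_left h16' (by positivity)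
  linarith

/-- Bare-coupling form (`β_W = 4/g²` for `SU(2)`): the door `β_W < (1 − Λ_R)/8` is `g² > 32/(1 − Λ_R)` — deep strong
coupling.  For comparison (memo §3): P2's Dobrushin ball `β_W ≤ 1/3 ⇔ g² ≥ 12`; Monte-Carlo crossover `β_W ≈ 2.3 ⇔
g² ≈ 1.74`; Bałaban's exit coupling `g_K ≤ γ ≪ 1`. [folklore] -/
theorem beDoor_gsq {g ΛR : ℝ} (hg : 0 < g) (hΛ : ΛR < 1) :
    4 / g ^ 2 < (1 - ΛR) / 8 ↔ 32 / (1 - ΛR) < g ^ 2 := by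
  have hg2 : 0 < g ^ 2 := by positivity
  have h1 : 0 < 1 - ΛR := by linarith
  rw [div_lt_div_iff₀ hg2 (by norm_num : (0 : ℝ) < 8), div_lt_iff₀ h1]
  constructor <;> intro h <;> nlinarith

/-- The mismatch on the Wilson-coupling axis, as exact rationals: crossover `2.3` over the pure Hessian door `1/8` is
`18.4`; over P2's ball radius `1/3` it is `6.9`; the Hessian door is the SHALLOWER of the two (`1/8 < 1/3`). [folklore] -/
theorem crossover_ratio :
    (23 / 10 : ℝ) / (1 / 8) = 92 / 5 ∧ (23 / 10 : ℝ) / (1 / 3) = 69 / 10 ∧ (1 / 8 : ℝ) < 1 / 3 := by norm_num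

/-- Budget reading of the door: a remainder of Hessian norm `Λ_R` COSTS `Λ_R/8` of Wilson coupling — at `Λ_R = 1/2` the
door is `β_W < 1/16`, and the door is shut for every `β_W ≥ 0` once `Λ_R ≥ 1` (`= N/2`, the Ricci constant of
`SU(2)` in the tree's normalisation). [folklore] -/
theorem beDoor_budget : ((1 : ℝ) - 1 / 2) / 8 = 1 / 16 ∧ ∀ ΛR : ℝ, 1 ≤ ΛR → ∀ βW : ℝ, 0 ≤ βW → ¬ βW < (1 - ΛR) / 8 := by
  refine ⟨by norm_num, fun ΛR hΛ βW hβ h => ?_⟩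
  have : (1 - ΛR) / 8 ≤ 0 := div_nonpos_of_nonpos_of_nonneg (by linarith) (by norm_num)
  linarith

end Numbers

end Summit.Ventures.YMGap.BEDoor
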